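import Summits.RiemannHypothesis.RiemannHypothesis.Theorems.GroundBartaEvenWinsBeyondArchDeflationWindowLoc1
import Literature.NumberTheory.LFunctions.WeilArchDensityRhoPanelTM
import HarnessLib

/-!
# RiemannHypothesis / GroundBarta — rung 4 (`EvenWinsBeyondArch`, stmt-RiemannHypothesis-18807 / 18085):
# the deflated Temple L-side, XIX d′ — window/vector bundles from kernel checks, `s_i` from the per-panel `q_j` (v2)

Helper file (`--supports stmt-RiemannHypothesis-18807`), RH-free, Mathlib + landed tree files only, no facts.  Prover B,
speedrun unit `sr-gb-rung-b` (gen 4).  The two ends of a generated per-window R-layer certificate (v2, R-LAYER.md §10):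
* START — entry-by-entry makers of the bundles `dt_WinL` / `dt_VecL` of file XIX b′: ρ-panel models (`dt_rho_entryL`,
  `dt_panelsL_cons`), their moments (`dt_momsL`, `dt_mem_momsL_of_eq`), G-moments on panel 0 (`dt_gmoms0L`,
  `dt_mem_gmoms0L_of_eq`), the even-grid local table of a vector (`dt_tabEntryL`, `dt_tabOK_of_eq`, `dt_tabL_spec`), the
  pole enclosures (`dt_mem_poleCosh/Sinh` of file XV′ from chunked `dt_poleSumI` facts), the constants (file XIX c);
  every kernel fact enters as an EQUATION `computed = literal` proven by `decide` in its own small theorem, so no chunk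
  exceeds the kernel budget;
* END — `dt_hs_of_panelQL`: the per-panel bounds give `∫‖F_i − Σ_l W_il v_l‖² ≤ 2 Σ_{j<m} q_j` (sigma-criterion input).

References: E. Bombieri, Rend. Mat. Acc. Lincei (9) 11 (2000) Thm 2 [Bombieri2000Weil]; Goerisch–Haunhorst (1985)
[GoerischHaunhorst1985].

(Part 2 of 2 of this topic; see part 1 for the overview.)
-/

set_option linter.dupNamespace false

noncomputable section

open MeasureTheory Set Filter intervalIntegral
open scoped Topology BigOperators

namespace Summit.RiemannHypothesis.RiemannHypothesis.Theorems.EvenWinsBeyondArch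

open Literature.NumberTheory.LFunctions
open Literature.Analysis.ValidatedNumerics Literature.Analysis.ValidatedNumerics.PolyMP
  Literature.Analysis.ValidatedNumerics.NumericsMP Literature.Analysis.ValidatedNumerics.ExpPoly

/-! ## The window bundle from checks -/

/-- `x.isSome ⇒ x = some (x.getD d)`. -/
theorem dt_eq_some_getD {α : Type} {x : Option α} (d : α) (h : x.isSome = true) : x = some (x.getD d) := by
  cases x with
  | none => simp at h
  | some a => rfl

/-- The ONE cheap check behind the window constants (`three = true`: `{2,3,4}`-window, else `{2,3}`-window). -/
def dt_constCheckL (S K Ke ke : ℕ) (c : ℚ) (m : ℕ) (three : Bool) : Bool :=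
  (dt_PsiFar S K Ke ke c).isSome && (MI.expPt S Ke ke (ofRat S (c / 2))).isSome &&
  (MI.expPt S Ke ke (ofRat S (-(c / 2)))).isSome && (dt_C0 S K).isSome &&
  (dt_IwSqrt S K Ke ke 2).isSome && (MI.logNat S K 2).isSome && (dt_IwSqrt S K Ke ke 3).isSome &&
  (MI.logNat S K 3).isSome && (dt_IwHalf S K).isSome && (MI.logNat S K 4).isSome &&
  (match dt_logRat S K (c / m) with | some Y => decide (Y.hi ≤ 0) | none => false) &&
  (if three then dt_threeWindowCheck S K c else dt_twoWindowCheck S K c)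

section MkWin

variable {S K Ke ke : ℕ} {c : ℚ} {m : ℕ} {three : Bool}

/-- What `dt_constCheckL` certifies about the shared constants. -/
theorem dt_constCheckL_sound (hS : 0 < S) (hc : 0 < c) (hm : 0 < m)
    (hchk : dt_constCheckL S K Ke ke c m three = true) :
    MI.mem S (weilArchTail (2 * (c : ℝ))) ((dt_PsiFar S K Ke ke c).getD default) ∧
    MI.mem S (Real.exp ((c : ℝ) / 2)) (expRatMI S Ke ke (c / 2)) ∧
    MI.mem S (Real.exp (-((c : ℝ) / 2))) (expRatMI S Ke ke (-(c / 2))) ∧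
    MI.mem S (Real.log 2 + Real.pi / 4) ((dt_C0 S K).getD default) ∧
    MI.mem S (Real.log 2 / Real.sqrt 2) ((dt_IwSqrt S K Ke ke 2).getD default) ∧
    MI.mem S (Real.log 2) ((MI.logNat S K 2).getD default) ∧
    MI.mem S (Real.log 3 / Real.sqrt 3) ((dt_IwSqrt S K Ke ke 3).getD default) ∧
    MI.mem S (Real.log 3) ((MI.logNat S K 3).getD default) ∧
    MI.mem S (Real.log 2 / 2) ((dt_IwHalf S K).getD default) ∧
    MI.mem S (Real.log 4) ((MI.logNat S K 4).getD default) ∧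
    ((((((dt_logRat S K (c / m)).getD default).lo : ℚ) / S : ℚ) : ℝ) ≤ Real.log (2 * ((c / (2 * m) : ℚ) : ℝ)) ∧
      Real.log (2 * ((c / (2 * m) : ℚ) : ℝ)) ≤ (((((dt_logRat S K (c / m)).getD default).hi : ℚ) / S : ℚ) : ℝ) ∧
      ((((dt_logRat S K (c / m)).getD default).hi : ℚ) / S : ℚ) ≤ 0) ∧
    (if three then Real.log 2 < (c : ℝ) ∧ (c : ℝ) ≤ Real.log 5 / 2 else Real.log 3 / 2 < (c : ℝ) ∧ (c : ℝ) ≤ Real.log 2) := by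
  unfold dt_constCheckL at hchk
  simp only [Bool.and_eq_true] at hchk
  obtain ⟨⟨⟨⟨⟨⟨⟨⟨⟨⟨⟨hPsi, hEp⟩, hEm⟩, hC0⟩, hw1⟩, hL1⟩, hw2⟩, hL2⟩, hw3⟩, hL4⟩, hlog⟩, hwin⟩ := hchk
  cases hY : dt_logRat S K (c / m) with
  | none => simp [hY] at hlog
  | some Y =>
    simp only [hY, decide_eq_true_eq] at hlog
    obtain ⟨hlo, hhi⟩ := dt_log_twoH_bounds hS hm hY (c := c)
    refine ⟨dt_mem_PsiFar hS hc (dt_eq_some_getD default hPsi), dt_mem_expHalf hS hEp, dt_mem_expNegHalf hS hEm,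
      dt_mem_C0 hS (dt_eq_some_getD default hC0), dt_mem_IwSqrt hS two_pos (dt_eq_some_getD default hw1),
      ?_, dt_mem_IwSqrt hS three_pos (dt_eq_some_getD default hw2), ?_, dt_mem_IwHalf hS (dt_eq_some_getD default hw3),
      ?_, ⟨?_, ?_, ?_⟩, ?_⟩
    · have := dt_mem_logNat hS (dt_eq_some_getD default hL1); push_cast at this; exact this
    · have := dt_mem_logNat hS (dt_eq_some_getD default hL2); push_cast at this; exact this
    · have := dt_mem_logNat hS (dt_eq_some_getD default hL4); push_cast at this; exact this
    · simpa using hlo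
    · simpa using hhi
    · simp only [Option.getD_some]
      have hS' : (0 : ℚ) < S := by exact_mod_cast hS
      exact div_nonpos_of_nonpos_of_nonneg (by exact_mod_cast hlog) hS'.le
    · cases three with
      | true => simpa using dt_threeWindow_sound hS (by simpa using hwin)
      | false => simpa using dt_twoWindow_sound hS (by simpa using hwin)

/-- **The v2 window bundle from checks and entry facts** (three-slot windows `log 2 < c ≤ (log 5)/2`). -/
def dt_mkWinL (hS : 0 < S) (hc : 0 < c) (hm : 0 < m) {Dl : ℕ} (hchk : dt_constCheckL S K Ke ke c m true = true)
    {Dρ : List (IPoly × Poly)} (hDρl : Dρ.length = 2 * m)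
    (hDρ : ∀ i : Fin Dρ.length, 1 ≤ (i : ℕ) →
      TMem S (c / (2 * m)) (fun u ↦ weilArchDensity ((PolyMP.panelCentre (c / (2 * m)) i : ℝ) + u)) (Dρ.get i).1)
    {mu : List (List MI)}
    (hmu : ∀ i, 1 ≤ i → i < 2 * m → ∀ b, b < Dl + 1 →
      MI.mem S (∫ u in (-((c / (2 * m) : ℚ) : ℝ))..((c / (2 * m) : ℚ) : ℝ),
        weilArchDensity (((PolyMP.panelCentre (c / (2 * m)) i : ℚ) : ℝ) + u) * u ^ b) ((mu.getD i []).getD b default))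
    {M0 : List MI}
    (hM0 : ∀ j, j < M0.length →
      MI.mem S (∫ t in (0 : ℝ)..(2 * ((c / (2 * m) : ℚ) : ℝ)), weilArchDensityG t * t ^ j) (M0.getD j default))
    {DG0 : IPoly × Poly}
    (hDG0 : TMem S (c / (2 * m)) (fun u ↦ weilArchDensityG (((PolyMP.panelCentre (c / (2 * m)) 0 : ℚ) : ℝ) + u)) DG0.1)
    (Qinv : Poly) (eK : ℕ) (pK : Poly) : dt_WinL S c m Dl where
  w1 := Real.log 2 / Real.sqrt 2
  L1 := Real.log 2
  w2 := Real.log 3 / Real.sqrt 3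
  L2 := Real.log 3
  w3 := Real.log 2 / 2
  L3 := Real.log 4
  Dρ := Dρ
  mu := mu
  M0 := M0
  DG0 := DG0
  Qinv := Qinv
  eK := eK
  pK := pK
  PsiFar := (dt_PsiFar S K Ke ke c).getD default
  C0 := (dt_C0 S K).getD default
  Iw1 := (dt_IwSqrt S K Ke ke 2).getD default
  IL1 := (MI.logNat S K 2).getD default
  Iw2 := (dt_IwSqrt S K Ke ke 3).getD default
  IL2 := (MI.logNat S K 3).getD default
  Iw3 := (dt_IwHalf S K).getD default
  IL3 := (MI.logNat S K 4).getD default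
  llo := ((((dt_logRat S K (c / m)).getD default).lo : ℚ) / S : ℚ)
  lhi := ((((dt_logRat S K (c / m)).getD default).hi : ℚ) / S : ℚ)
  hDρl := hDρl
  hDρ := hDρ
  hmu := hmu
  hM0 := hM0
  hDG0 := hDG0
  hFar := (dt_constCheckL_sound hS hc hm hchk).1
  hC0 := (dt_constCheckL_sound hS hc hm hchk).2.2.2.1
  hw1 := (dt_constCheckL_sound hS hc hm hchk).2.2.2.2.1
  hL1 := (dt_constCheckL_sound hS hc hm hchk).2.2.2.2.2.1
  hw2 := (dt_constCheckL_sound hS hc hm hchk).2.2.2.2.2.2.1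
  hL2 := (dt_constCheckL_sound hS hc hm hchk).2.2.2.2.2.2.2.1
  hw3 := (dt_constCheckL_sound hS hc hm hchk).2.2.2.2.2.2.2.2.1
  hL3 := (dt_constCheckL_sound hS hc hm hchk).2.2.2.2.2.2.2.2.2.1
  hllo := (dt_constCheckL_sound hS hc hm hchk).2.2.2.2.2.2.2.2.2.2.1.1
  hlhi := (dt_constCheckL_sound hS hc hm hchk).2.2.2.2.2.2.2.2.2.2.1.2.1
  hlhi0 := (dt_constCheckL_sound hS hc hm hchk).2.2.2.2.2.2.2.2.2.2.1.2.2

/-- The prime-slot identity of a three-slot window, from the same check (for `dt_hs_of_panelQL`'s `hprimes`). -/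
theorem dt_mkWinL_window (hS : 0 < S) (hc : 0 < c) (hm : 0 < m) (hchk : dt_constCheckL S K Ke ke c m true = true) :
    Real.log 2 < (c : ℝ) ∧ (c : ℝ) ≤ Real.log 5 / 2 := by
  have := (dt_constCheckL_sound hS hc hm hchk).2.2.2.2.2.2.2.2.2.2.2
  simpa using this

end MkWin

/-! ## Parity of a coefficient list (for the `hgp` premise) -/

/-- `true` iff every coefficient of even (resp. odd, when `odd = false`) index vanishes: `p` is odd (resp. even). -/
def dt_parityCheck : Bool → Poly → Bool
  | _, [] => true
  | true, a :: p => decide (a = 0) && dt_parityCheck false p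
  | false, _ :: p => dt_parityCheck true p

/-- **Parity from the check**: `eval p (−x) = σ · eval p x` with `σ = −1` (odd check) or `σ = 1` (even check). -/
theorem dt_eval_neg_of_parityCheck : ∀ (odd : Bool) (p : Poly), dt_parityCheck odd p = true →
    ∀ x : ℝ, Poly.eval p (-x) = (if odd then -1 else 1) * Poly.eval p x
  | _, [], _, x => by simp [Poly.eval]
  | true, a :: p, h, x => by
      simp only [dt_parityCheck, Bool.and_eq_true, decide_eq_true_eq] at h
      have ih := dt_eval_neg_of_parityCheck false p h.2 x
      simp only [Bool.false_eq_true, if_false, one_mul] at ih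
      simp only [Poly.eval, h.1, ih, if_true]
      push_cast; ring
  | false, a :: p, h, x => by
      simp only [dt_parityCheck] at h
      have ih := dt_eval_neg_of_parityCheck true p h x
      simp only [if_true] at ih
      simp only [Poly.eval, ih, Bool.false_eq_true, if_false]
      ring

/-- Odd vectors: `eval (gp i) (−x) = −eval (gp i) x` for all `i`, from the checks. -/
theorem dt_hgp_odd {k : ℕ} (gp : Fin k → Poly) (h : ∀ i, dt_parityCheck true (gp i) = true) :
    ∀ i x, Poly.eval (gp i) (-x) = (-1 : ℝ) * Poly.eval (gp i) x := fun i x ↦ by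
  simpa using dt_eval_neg_of_parityCheck true (gp i) (h i) x

/-- Even vectors. -/
theorem dt_hgp_even {k : ℕ} (gp : Fin k → Poly) (h : ∀ i, dt_parityCheck false (gp i) = true) :
    ∀ i x, Poly.eval (gp i) (-x) = (1 : ℝ) * Poly.eval (gp i) x := fun i x ↦ by
  simpa using dt_eval_neg_of_parityCheck false (gp i) (h i) x

/-! ## Rescaling `P(x/b)` to a polynomial in `x` (bridge to the dyadic vectors `dt_wY P b`) -/

/-- The coefficient list of `x ↦ P(x/b)`: `P_k / b^k`. -/
def dt_rescaleQ (P : Poly) (b : ℚ) : Poly := (List.range P.length).map fun k ↦ P.getD k 0 / b ^ k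

/-- `eval (dt_rescaleQ P b) x = eval P (x/b)`. -/
theorem dt_eval_rescaleQ (P : Poly) (b : ℚ) (x : ℝ) : Poly.eval (dt_rescaleQ P b) x = Poly.eval P (x / b) := by
  rw [Poly.eval_eq_evalR, Poly.eval_eq_evalR, dt_rescaleQ, List.map_map]
  have e1 := evalR_map_range (fun k ↦ (((P.getD k 0 / b ^ k : ℚ)) : ℝ)) x P.length
  rw [show (List.range P.length).map (((↑) : ℚ → ℝ) ∘ fun k ↦ P.getD k 0 / b ^ k) =
      (List.range P.length).map (fun k ↦ (((P.getD k 0 / b ^ k : ℚ)) : ℝ)) from rfl, e1,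
    evalR_eq_sum, List.length_map]
  refine Finset.sum_congr rfl fun k hk ↦ ?_
  have hk' : k < P.length := Finset.mem_range.1 hk
  rw [List.getD_eq_getElem (l := P.map ((↑) : ℚ → ℝ)) (d := (0 : ℝ)) (hn := by simpa using hk'), List.getElem_map,
    List.getD_eq_getElem (l := P) (d := (0 : ℚ)) (hn := hk')]
  push_cast
  rw [div_pow, div_mul_eq_mul_div, mul_div_assoc]

/-! ## The residual norm from the per-panel bounds -/

/-! ## From the per-panel bounds to the residual norm `s_i` -/

section Assembly

variable {c : ℚ} {k : ℕ} {gp : Fin k → Poly} {v F : Fin k → ℝ → ℂ}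

/-- **`hs` of the sigma criterion from the per-panel bounds.**  Parity-`σ` polynomial trial vectors `g_i = eval (gp i)` on
`[-c, c]`, window images `F_i`, the three-slot form of the prime sum (`dt_hprimes_two/three`), rational stand-ins `M̃`, `W̃`,
and for every y-panel `j < m` a bound `q_j` of `∫_{-h}^{h} R_i(y_j+ρ)² dρ` (from `dt_panelQL_bulk/_split/_edge`, the
integrability premise being supplied here): then, with `W_il = W̃_il + [l = i](M̃ − M_c)`,
`∫ ‖F_i − Σ_l W_il v_l‖² ≤ 2 Σ_{j<m} q_j`. [cite: GoerischHaunhorst1985, §2] [cite: Bombieri2000Weil, Thm 2] -/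
theorem dt_hs_of_panelQL (hc : 0 < c) {σ : ℝ} (hσ : σ = 1 ∨ σ = -1)
    (hgp : ∀ i x, Poly.eval (gp i) (-x) = σ * Poly.eval (gp i) x)
    (hv : ∀ i x, v i x = (((Icc (-(c : ℝ)) c).indicator (fun x ↦ Poly.eval (gp i) x) x : ℝ) : ℂ))
    (hF : ∀ i y, F i y = (Icc (-(c : ℝ)) c).indicator (fun y ↦
        2 * (∫ x, v i x * (Real.cosh (x / 2) : ℂ)) * (Real.cosh (y / 2) : ℂ) -
          2 * (∫ x, v i x * (Real.sinh (x / 2) : ℂ)) * (Real.sinh (y / 2) : ℂ) +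
        (∑ n ∈ weilPrimeIndex (c : ℝ), (((ArithmeticFunction.vonMangoldt n : ℝ) / Real.sqrt n : ℝ) : ℂ) *
          (2 * v i y - v i (y - Real.log n) - v i (y + Real.log n))) +
        ∫ t in Ioi 0, (weilArchDensity t : ℂ) * (2 * v i y - v i (y - t) - v i (y + t))) y -
      (weilMarkovConstant (c : ℝ) : ℂ) * v i y)
    {w1 L1 w2 L2 w3 L3 : ℝ} (Mt : ℚ) (Wt : Fin k → Fin k → ℚ) (i : Fin k)
    (hprimes : ∀ y : ℝ, ∑ n ∈ weilPrimeIndex (c : ℝ), ((ArithmeticFunction.vonMangoldt n : ℝ) / Real.sqrt n) *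
        (2 * Poly.eval (gp i) y - (Icc (-(c : ℝ)) c).indicator (fun x ↦ Poly.eval (gp i) x) (y - Real.log n) -
          (Icc (-(c : ℝ)) c).indicator (fun x ↦ Poly.eval (gp i) x) (y + Real.log n)) =
      w1 * (2 * Poly.eval (gp i) y - (Icc (-(c : ℝ)) c).indicator (fun x ↦ Poly.eval (gp i) x) (y - L1) -
          (Icc (-(c : ℝ)) c).indicator (fun x ↦ Poly.eval (gp i) x) (y + L1)) +
        w2 * (2 * Poly.eval (gp i) y - (Icc (-(c : ℝ)) c).indicator (fun x ↦ Poly.eval (gp i) x) (y - L2) -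
          (Icc (-(c : ℝ)) c).indicator (fun x ↦ Poly.eval (gp i) x) (y + L2)) +
        w3 * (2 * Poly.eval (gp i) y - (Icc (-(c : ℝ)) c).indicator (fun x ↦ Poly.eval (gp i) x) (y - L3) -
          (Icc (-(c : ℝ)) c).indicator (fun x ↦ Poly.eval (gp i) x) (y + L3)))
    {m : ℕ} (hm : 0 < m) (q : ℕ → ℚ)
    (hq : ∀ j, j < m →
      IntervalIntegrable (fun ρ ↦ dt_windowResidual (c : ℝ) gp w1 L1 w2 L2 w3 L3 (Mt : ℝ) (fun a l ↦ (Wt a l : ℝ)) i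
        (((PolyMP.panelCentre (c / (2 * m)) j : ℚ) : ℝ) + ρ) ^ 2) volume (-((c / (2 * m) : ℚ) : ℝ)) ((c / (2 * m) : ℚ) : ℝ) →
      ∫ ρ in (-((c / (2 * m) : ℚ) : ℝ))..((c / (2 * m) : ℚ) : ℝ),
          dt_windowResidual (c : ℝ) gp w1 L1 w2 L2 w3 L3 (Mt : ℝ) (fun a l ↦ (Wt a l : ℝ)) i
            (((PolyMP.panelCentre (c / (2 * m)) j : ℚ) : ℝ) + ρ) ^ 2 ≤ ((q j : ℚ) : ℝ)) :
    ∫ y, ‖(F i - ∑ l, ((Wt i l : ℝ) + if l = i then (Mt : ℝ) - weilMarkovConstant (c : ℝ) else 0) • v l) y‖ ^ 2 ≤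
      2 * ∑ j ∈ Finset.range m, ((q j : ℚ) : ℝ) := by
  have hc' : (0 : ℝ) < c := by exact_mod_cast hc
  refine dt_residual_normSq_le_of_panelBounds hc' hσ hgp hv hF (Mt : ℝ) (fun a l ↦ (Wt a l : ℝ)) i hprimes hm
    (fun j ↦ ((q j : ℚ) : ℝ)) fun j hj ↦ ?_
  have e1 : (2 * (j : ℝ) + 1) * ((c : ℝ) / (2 * m)) = ((PolyMP.panelCentre (c / (2 * m)) j : ℚ) : ℝ) :=
    (dt_panelCentre_castL c m j).symm
  have e2 : (c : ℝ) / (2 * m) = ((c / (2 * m) : ℚ) : ℝ) := (dt_halfWidth_cast c m).symm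
  have hRi := dt_windowResidual_sq_intervalIntegrable hc' hv hF (Mt : ℝ) (fun a l ↦ (Wt a l : ℝ)) i hprimes hm hj
  rw [e1, e2] at hRi ⊢
  exact hq j hj hRi

end Assembly

end Summit.RiemannHypothesis.RiemannHypothesis.Theorems.EvenWinsBeyondArch

end
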